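import Literature.Geometry.Riemannian.WeylEnergy
import HarnessLib

/-!
# Curvature quantities only depend on the values of the metric (not on its regularity index)

Topic `Geometry/Lorentzian` (everything proved; no definition, no named fact). Two
pseudo-Riemannian metrics `g₁ : PseudoRiemannianMetric I n₁ E TM`, `g₂ : PseudoRiemannianMetric I n₂ E TM`
on the same manifold, possibly carried at DIFFERENT regularity indices `n₁, n₂` (e.g. a `C^∞`
metric and the same metric regarded as a `C²` one through `PseudoRiemannianMetric.ofLE`, or a
`C²` pullback `Φ^* ḡ` which happens to coincide with a smooth conformal metric `ψ² g`), which
have the same values `g₁.val = g₂.val`, have the same Koszul functional, Levi-Civita connection,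
Riemann / Ricci / scalar curvature, covariant curvature tensor, frame Weyl tensor, orthonormal
frames and Weyl norm: all these are DEFINED from `g.val` alone (O'Neill 1983, Ch. 3, Thm. 3.11:
the Levi-Civita connection is characterised by the Koszul formula, which involves only the metric
and brackets). The regularity index only enters the existence theorems.

* `koszulFunctional_congr_of_val_eq`, `leviCivitaFun_congr_of_val_eq`,
  `leviCivita_congr_of_val_eq`, `riemann_congr_of_val_eq`, `ricci_congr_of_val_eq`,
  `trace_congr_of_val_eq'` (metrics at two regularity indices; the same-index cross-base version
  is `trace_congr_of_val_eq` of `HypersurfaceRestriction.lean`), `scalarCurvature_congr_of_val_eq`,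
  `curvatureForm_congr_of_val_eq`, `weylFrame_congr_of_val_eq`, `isOrthonormalFrame_congr_of_val_eq`,
  `weylNormSqFrame_congr_of_val_eq`, `weylNormSq_congr_of_val_eq`.

Use: the curvature decay of a conformally compact metric (Li–Qing–Shi 2017, Lemma 1.6; proof of
Thm. 1.8, Step 1), where the `C²` pullback `j^* ḡ` of the compactified metric along the interior
embedding and the smooth conformal metric `(ρ ∘ j)² g⁺` have the same values.

## References

* B. O'Neill, *Semi-Riemannian geometry* (1983), Ch. 3, Thm. 3.11, Lemma 3.35, Def. 3.51–3.53.
  [ONeill1983]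
* G. Li, J. Qing, Y. Shi, Trans. Amer. Math. Soc. 369 (2017) 4385–4413 (arXiv:1410.6402),
  Def. 2.1, Lemma 1.6. [LiQingShi2017]
-/

noncomputable section

open Bundle Set Function
open scoped Manifold ContDiff Topology

namespace Literature.Geometry.Lorentzian

namespace PseudoRiemannianMetric

variable {E : Type*} [NormedAddCommGroup E] [NormedSpace ℝ E] {H : Type*} [TopologicalSpace H]
  {I : ModelWithCorners ℝ E H} {M : Type*} [TopologicalSpace M] [ChartedSpace H M]
  [IsManifold I ∞ M] {n₁ n₂ : ℕ∞ω}
  {g₁ : PseudoRiemannianMetric I n₁ E (TangentSpace I : M → Type _)}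
  {g₂ : PseudoRiemannianMetric I n₂ E (TangentSpace I : M → Type _)}

/-- Metrics with the same values have the same Koszul functional. [cite: ONeill1983, Ch. 3, Thm. 3.11] -/
theorem koszulFunctional_congr_of_val_eq (h : ∀ x, g₁.val x = g₂.val x) :
    g₁.koszulFunctional = g₂.koszulFunctional := by
  have hv : g₁.val = g₂.val := funext h
  funext X Y Z x
  simp only [koszulFunctional, hv]

omit [IsManifold I ∞ M] in
open scoped Classical in
/-- Choosing a witness of equal predicates gives equal values (bookkeeping for the `dite` in
`leviCivitaFun`). [folklore] -/
private theorem dite_exists_choose_congr {α : Type*} [Zero α] {p q : α → Prop} (hpq : p = q) :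
    (if hp : ∃ a, p a then hp.choose else 0) = (if hq : ∃ a, q a then hq.choose else 0) := by
  subst hpq
  rfl

/-- Metrics with the same values have the same Levi-Civita map `leviCivitaFun` (the Koszul
characterisation involves only the values of the metric). [cite: ONeill1983, Ch. 3, Thm. 3.11] -/
theorem leviCivitaFun_congr_of_val_eq (h : ∀ x, g₁.val x = g₂.val x) :
    g₁.leviCivitaFun = g₂.leviCivitaFun := by
  have hv : g₁.val = g₂.val := funext h
  have hk := koszulFunctional_congr_of_val_eq h
  funext Y x
  unfold leviCivitaFun
  have hQ : (fun A : TangentSpace I x →L[ℝ] TangentSpace I x ↦ ∀ X₀ Z₀ : TangentSpace I x,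
      2 * g₁.val x (A X₀) Z₀ =
        g₁.koszulFunctional (FiberBundle.extend E X₀) Y (FiberBundle.extend E Z₀) x) =
      (fun A : TangentSpace I x →L[ℝ] TangentSpace I x ↦ ∀ X₀ Z₀ : TangentSpace I x,
      2 * g₂.val x (A X₀) Z₀ =
        g₂.koszulFunctional (FiberBundle.extend E X₀) Y (FiberBundle.extend E Z₀) x) := by
    funext A
    simp only [hv, hk]
  exact dite_exists_choose_congr hQ

variable [g₁.HasLeviCivita] [g₂.HasLeviCivita]

/-- **Metrics with the same values have the same Levi-Civita connection** (whatever their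
regularity indices). [cite: ONeill1983, Ch. 3, Thm. 3.11] -/
theorem leviCivita_congr_of_val_eq (h : ∀ x, g₁.val x = g₂.val x) :
    g₁.leviCivita = g₂.leviCivita := by
  apply CovariantDerivative.ext
  show g₁.leviCivitaFun = g₂.leviCivitaFun
  exact leviCivitaFun_congr_of_val_eq h

/-- … hence the same Riemann curvature tensor. [cite: ONeill1983, Ch. 3, Lemma 3.35] -/
theorem riemann_congr_of_val_eq (h : ∀ x, g₁.val x = g₂.val x) (x : M) :
    g₁.riemann x = g₂.riemann x := by
  unfold riemann
  rw [leviCivita_congr_of_val_eq h]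

/-- … the same Ricci tensor. [cite: ONeill1983, Ch. 3, Def. 3.51] -/
theorem ricci_congr_of_val_eq (h : ∀ x, g₁.val x = g₂.val x) (x : M) :
    g₁.ricci x = g₂.ricci x := by
  unfold ricci
  rw [leviCivita_congr_of_val_eq h]

variable [FiniteDimensional ℝ E]

omit [g₁.HasLeviCivita] [g₂.HasLeviCivita] in
/-- The metric trace only depends on the scalar product on the fibre (metrics at two regularity
indices; compare `trace_congr_of_val_eq` of `HypersurfaceRestriction.lean`).
[cite: ONeill1983, Ch. 3, pp. 60–61] -/
theorem trace_congr_of_val_eq' {x : M} (h : g₁.val x = g₂.val x)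
    (T : LinearMap.BilinForm ℝ (TangentSpace I x)) : g₁.trace x T = g₂.trace x T := by
  haveI : FiniteDimensional ℝ (TangentSpace I x) := ‹FiniteDimensional ℝ E›
  -- both traces are `F B hB` for the scalar product `B` on the fibre
  let F : (B : LinearMap.BilinForm ℝ (TangentSpace I x)) → B.Nondegenerate → ℝ := fun B hB ↦
    LinearMap.trace ℝ (TangentSpace I x) ((B.toDual hB).symm.toLinearMap ∘ₗ T)
  have hF : ∀ (B₁ B₂ : LinearMap.BilinForm ℝ (TangentSpace I x)) (p₁ : B₁.Nondegenerate)
      (p₂ : B₂.Nondegenerate), B₁ = B₂ → F B₁ p₁ = F B₂ p₂ := by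
    rintro B₁ _ p₁ p₂ rfl
    rfl
  have hB : (g₁.toBilinForm x : LinearMap.BilinForm ℝ (TangentSpace I x)) = g₂.toBilinForm x :=
    congrArg (fun X : TangentSpace I x →L[ℝ] TangentSpace I x →L[ℝ] ℝ ↦
      (X.toLinearMap₁₂ : LinearMap.BilinForm ℝ (TangentSpace I x))) h
  exact hF (g₁.toBilinForm x) (g₂.toBilinForm x) (g₁.nondegenerate_toBilinForm x)
    (g₂.nondegenerate_toBilinForm x) hB

/-- … the same scalar curvature. [cite: ONeill1983, Ch. 3, Def. 3.53] -/
theorem scalarCurvature_congr_of_val_eq (h : ∀ x, g₁.val x = g₂.val x) (x : M) :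
    g₁.scalarCurvature x = g₂.scalarCurvature x := by
  unfold scalarCurvature
  rw [ricci_congr_of_val_eq h x, trace_congr_of_val_eq' (h x)]

omit [FiniteDimensional ℝ E] in
/-- … the same covariant curvature tensor `Rm(X,Y,Z,W) = g(R(X,Y)Z, W)` of their Levi-Civita
connections. [cite: ONeill1983, Ch. 3, Lemma 3.35] -/
theorem curvatureForm_congr_of_val_eq (h : ∀ x, g₁.val x = g₂.val x) (x : M)
    (X Y Z W : TangentSpace I x) :
    g₁.curvatureForm g₁.leviCivita x X Y Z W = g₂.curvatureForm g₂.leviCivita x X Y Z W := by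
  unfold curvatureForm
  rw [leviCivita_congr_of_val_eq h, h x]

/-- … the same frame Weyl tensor (`WeylEnergy.lean`). [folklore] -/
theorem weylFrame_congr_of_val_eq (h : ∀ x, g₁.val x = g₂.val x) (x : M)
    {ι : Type*} [Fintype ι] [DecidableEq ι] (e : ι → TangentSpace I x) (i j k l : ι) :
    g₁.weylFrame x e i j k l = g₂.weylFrame x e i j k l := by
  simp only [Literature.Geometry.Lorentzian.PseudoRiemannianMetric.weylFrame_apply,
    curvatureForm_congr_of_val_eq h, ricci_congr_of_val_eq h, scalarCurvature_congr_of_val_eq h]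

omit [FiniteDimensional ℝ E] [g₁.HasLeviCivita] [g₂.HasLeviCivita] in
/-- Metrics with the same values have the same orthonormal frames. [folklore] -/
theorem isOrthonormalFrame_congr_of_val_eq (h : ∀ x, g₁.val x = g₂.val x) (x : M) {ι : Type*}
    (e : ι → TangentSpace I x) : g₁.IsOrthonormalFrame x e ↔ g₂.IsOrthonormalFrame x e := by
  simp only [Literature.Geometry.Lorentzian.PseudoRiemannianMetric.IsOrthonormalFrame, h x]

/-- … the same frame Weyl norms `Σ W²`. [folklore] -/
theorem weylNormSqFrame_congr_of_val_eq (h : ∀ x, g₁.val x = g₂.val x) (x : M)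
    {ι : Type*} [Fintype ι] [DecidableEq ι] (e : ι → TangentSpace I x) :
    g₁.weylNormSqFrame x e = g₂.weylNormSqFrame x e := by
  simp only [Literature.Geometry.Lorentzian.PseudoRiemannianMetric.weylNormSqFrame,
    weylFrame_congr_of_val_eq h]

/-- … and the same pointwise Weyl norm `|W|²` (`WeylEnergy.lean`). [folklore] -/
theorem weylNormSq_congr_of_val_eq (h : ∀ x, g₁.val x = g₂.val x) (x : M) :
    g₁.weylNormSq x = g₂.weylNormSq x := by
  unfold weylNormSq
  have hset : ∀ e : Fin (Module.finrank ℝ E) → TangentSpace I x,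
      g₁.IsOrthonormalFrame x e ↔ g₂.IsOrthonormalFrame x e :=
    fun e ↦ isOrthonormalFrame_congr_of_val_eq h x e
  -- reindex the supremum along the equivalence of the two (equal) frame subtypes
  let φ : {e : Fin (Module.finrank ℝ E) → TangentSpace I x // g₁.IsOrthonormalFrame x e} ≃
      {e : Fin (Module.finrank ℝ E) → TangentSpace I x // g₂.IsOrthonormalFrame x e} :=
    Equiv.subtypeEquivRight hset
  rw [← φ.iSup_comp]
  congr 1
  funext e
  exact weylNormSqFrame_congr_of_val_eq h x _

end PseudoRiemannianMetric

end Literature.Geometry.Lorentzian
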